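import Literature.AlgebraicGeometry.Resolution.AlterationsBlowupDivisor
import Literature.AlgebraicGeometry.Resolution.ResolutionOfCurves
import Literature.AlgebraicGeometry.Resolution.MarkedIdealsLemmas
import Literature.AlgebraicGeometry.Motives.ProjectiveOfGeneratingSections
import Mathlib.AlgebraicGeometry.Morphisms.SchemeTheoreticallyDominant
import HarnessLib

/-!
# De Jong's alteration theorem: the normalisation step 4.10 — `DeJong1996NormalizationReduction` discharged

Topic: `Literature/AlgebraicGeometry/Resolution`. Third layer under `AlterationsInduction.lean`
(the induction step of de Jong 1996, Thm. 4.1 split at 4.10 into `DeJong1996NormalProjectiveReduction`,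
4.6–4.10, and `DeJong1996NormalProjectiveStep`, 4.11–4.28), after `AlterationsCompactification.lean`
(4.6, 4.7 proved) and `AlterationsBlowupDivisor.lean` (4.8 proved modulo the projectivity of
blow-ups `BlowupProjectiveOverField`, and 4.10 vendored as the named fact
`DeJong1996NormalizationReduction`). This file PROVES 4.10 unconditionally:

* `IsEffectiveCartier.comap_of_isDominant` — "4.10. The property (iv) is preserved if we apply
  any alteration `φ : X' → X` as in 4.4": effective Cartier divisors pull back to effective
  Cartier divisors along dominant quasi-compact morphisms of integral schemes (a local equation
  is a non-zero element of a domain, and `Γ(X, U) → Γ(X', V)` is injective for `φ` dominant,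
  `Scheme.Hom.app_injective` for the scheme-theoretically dominant `φ`, and restrictions on the
  integral `X'`, `presheaf_map_injective_of_isIntegral`).
* `isIntegrallyClosed_stalk_normalization` — the normalisation `X^ν` (`normalization X`,
  `NormalizationOfVarieties.lean`) of an integral scheme is normal: its local rings are
  localisations of `Γ(X^ν, ν⁻¹U) ≅` the integral closure of `Γ(X, U)` in `K(X)`
  (`Scheme.Hom.normalizationObjIso`), which is integrally closed.
* `isGenericallyEtale_normalizationι` — for a variety, `ν : X^ν → X` is generically étale: it is
  an isomorphism over a non-empty normal affine open (`exists_isAffineOpen_isIntegrallyClosed`,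
  `isIso_normalizationι_morphismRestrict`, `ResolutionOfCurves.lean`; finiteness of the
  normalisation, E. Noether, `NoetherFiniteIntegralClosure_holds`).
* `isProjectiveOver_normalization` — "(iii) holds as long as we only take projective alterations
  `φ`. In particular, taking `φ` equal to the normalization morphism": `X^ν → X ↪ ℙⁿ_k` is finite
  and `X^ν` proper over `k`, so `X^ν` is projective
  (`Literature.AlgebraicGeometry.Motives.isProjectiveOver_of_isFinite`, Görtz–Wedhorn I,
  Thm. 13.84 with Cor. 13.72).
* `DeJong1996.conclusionGenericallyEtale_of_normal` — **4.10** for one pair, over any field: for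
  `X` a projective variety and `Z` the support of an effective Cartier divisor, Thm. 4.1 with its
  generically-étale clause for `(X, Z)` follows from the same statement for all normal projective
  pairs (`DeJong1996.NormalProjectivePair`) of the same dimension (via `ν` and 4.4,
  `DeJong1996.ConclusionGenericallyEtale.of_isAlteration`, `isAlteration_normalizationι`).
* `DeJong1996NormalizationReduction_holds` — the DISCHARGE of the named fact of
  `AlterationsBlowupDivisor.lean`; consequently (`…of_blowupProjective…`)
  `BlowupProjectiveOverField → DeJong1996NormalProjectiveReduction`, and `DeJong1996InductionStep`,
  `DeJong1996StrongAlgClosed`, `DeJong1996Strong`, `DeJong1996StrongPerfect` from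
  `BlowupProjectiveOverField`, `DeJong1996NormalProjectiveStep` (4.11–4.28) and (for the last two)
  `DeJong1996Descent` (4.5). The live nodes of the DAG of Thm. 4.1 are now
  `DeJong1996.FiniteSubextension45`, `BlowupProjectiveOverField`, `DeJong1996NormalProjectiveStep`.

## Sources

* A. J. de Jong, *Smoothness, semi-stability and alterations*, Publ. Math. IHÉS 83 (1996) 51–93:
  2.3 (p. 55), 2.20 (p. 61), 4.4, 4.9–4.10 (pp. 66–67).
* Q. Liu, *Algebraic Geometry and Arithmetic Curves* (2002), Def. 4.1.24, Prop. 4.1.27,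
  Cor. 4.1.30 (the normalisation of a variety is finite).
* U. Görtz, T. Wedhorn, *Algebraic Geometry I*, 2nd ed. (2020), Thm. 13.84, Cor. 13.72,
  Cor. 13.77 (finite morphisms are projective).
* The Stacks Project, Tag 033H (normal schemes), Tag 035H (relative normalisation).
-/

noncomputable section

open CategoryTheory CategoryTheory.Limits AlgebraicGeometry TopologicalSpace Topology

namespace Literature.AlgebraicGeometry.Resolution

universe u

/-! ## (iv) is preserved by alterations (de Jong 1996, 4.10) -/

/-- On an integral scheme the restriction maps between non-empty opens are injective (both embed
in the function field). [folklore] -/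
theorem presheaf_map_injective_of_isIntegral {X : Scheme.{u}} [IsIntegral X] {U V : X.Opens}
    (h : V ≤ U) [hV : Nonempty V] : Function.Injective (X.presheaf.map (homOfLE h).op) := by
  have hηV : genericPoint X ∈ V :=
    ((genericPoint_spec X).mem_open_set_iff V.isOpen).mpr (by
      obtain ⟨v⟩ := hV
      exact ⟨v.1, Set.mem_univ _, v.2⟩)
  intro a b hab
  have e := congrArg (X.presheaf.germ V (genericPoint X) hηV) hab
  rw [TopCat.Presheaf.germ_res_apply, TopCat.Presheaf.germ_res_apply] at e
  exact germ_injective_of_isIntegral X (genericPoint X) _ e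

/-- **"The property (iv) is preserved if we apply any alteration `φ : X' → X`"** (de Jong 1996,
4.10): effective Cartier divisors pull back to effective Cartier divisors along dominant
quasi-compact morphisms of integral schemes — a local equation `g` of `D` on an affine `U` is a
regular, i.e. non-zero, element of the domain `Γ(X, U)`, and its image in `Γ(X', V)`, `V` affine
in `φ⁻¹(U)`, is non-zero since `φ^* : Γ(X, U) → Γ(X', φ⁻¹U)` is injective for `φ` dominant
(scheme-theoretically dominant, `X` being reduced) and so is the restriction to `V`.
[cite: DeJong1996, 4.10, p. 67] -/
theorem IsEffectiveCartier.comap_of_isDominant {X' X : Scheme.{u}} [IsIntegral X'] [IsIntegral X]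
    {K : X.IdealSheafData} (hK : IsEffectiveCartier K) (φ : X' ⟶ X) [IsDominant φ]
    [QuasiCompact φ] : IsEffectiveCartier (K.comap φ) := by
  haveI : IsSchemeTheoreticallyDominant φ := IsSchemeTheoreticallyDominant.of_isDominant φ
  intro x
  obtain ⟨W, hxW, b, hb, hKW⟩ := hK (φ x)
  obtain ⟨W₀, hW₀, hxW₀, hle⟩ :=
    exists_isAffineOpen_mem_and_subset (X := X') (x := x) (U := φ ⁻¹ᵁ (W : X.Opens)) hxW
  haveI : Nonempty (W₀ : X'.Opens) := ⟨⟨x, hxW₀⟩⟩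
  haveI : Nonempty (W : X.Opens) := ⟨⟨φ x, hxW⟩⟩
  refine ⟨⟨W₀, hW₀⟩, hxW₀, φ.appLE W W₀ hle b, ?_, ?_⟩
  · -- the image of the local equation is non-zero in the domain `Γ(X', W₀)`
    apply mem_nonZeroDivisors_of_ne_zero
    have hb0 : b ≠ 0 := nonZeroDivisors.ne_zero hb
    intro h0
    apply hb0
    have h1 : φ.app W b = 0 := by
      apply presheaf_map_injective_of_isIntegral (X := X') hle
      rw [map_zero]
      simpa [Scheme.Hom.appLE] using h0
    exact φ.app_injective W (by rw [h1, map_zero])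
  · rw [ideal_comap_of_le φ K W ⟨W₀, hW₀⟩ hle, hKW, Ideal.map_span, Set.image_singleton]

/-! ## The normalisation of a variety is normal, generically an isomorphism, and projective -/

section Normalization

variable (X : Scheme.{u}) [IsIntegral X]

/-- **The normalisation of an integral scheme is normal** (Stacks 033H: all local rings are
integrally closed domains): the local ring of `X^ν` at a point over the affine open `U = Spec A`
of `X` is a localisation of `Γ(X^ν, ν⁻¹U) ≅` the integral closure of `A` in `K(X)`, which is
integrally closed (Liu 2002, Def. 4.1.24 and Prop. 4.1.22), and localisations of integrally
closed domains are integrally closed. [folklore] -/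
theorem isIntegrallyClosed_stalk_normalization (x : normalization X) :
    IsIntegrallyClosed ((normalization X).presheaf.stalk x) := by
  obtain ⟨_, ⟨U, hU, rfl⟩, hxU, -⟩ := X.isBasis_affineOpens.exists_subset_of_mem_open
    (Set.mem_univ (normalizationι X x)) isOpen_univ
  haveI : Nonempty U := ⟨⟨_, hxU⟩⟩
  letI := ((fromSpecFunctionField X).app U).hom.toAlgebra
  -- the affine open `ν⁻¹ U` of `X^ν` and the stalk at `x` as a localisation of its sections
  have hV : IsAffineOpen (normalizationι X ⁻¹ᵁ U) := hU.preimage (normalizationι X)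
  haveI : Nonempty (normalizationι X ⁻¹ᵁ U : (normalization X).Opens) := ⟨⟨x, hxU⟩⟩
  letI := (normalization X).presheaf.algebra_section_stalk
    (⟨x, hxU⟩ : ↥(normalizationι X ⁻¹ᵁ U))
  haveI := hV.isLocalization_stalk ⟨x, hxU⟩
  -- `Γ(X^ν, ν⁻¹ U) ≅ integralClosure Γ(X, U) Γ(Spec K(X), ξ⁻¹ U) ≅ integralClosure Γ(X, U) K(X)`
  let A := Γ(X, U)
  haveI : IsFractionRing A X.functionField := functionField_isFractionRing_of_isAffineOpen X U hU
  haveI : IsIntegrallyClosed (integralClosure A X.functionField) :=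
    integralClosure.isIntegrallyClosedOfFiniteExtension (K := X.functionField)
      (L := X.functionField)
  let e := functionFieldAlgEquivSections (X := X) U
  let e₁ : integralClosure A X.functionField ≃+*
      integralClosure A Γ(Spec X.functionField, fromSpecFunctionField X ⁻¹ᵁ U) :=
    (((integralClosure A X.functionField).equivMapOfInjective e.toAlgHom
      e.injective).trans (Subalgebra.equivOfEq _ _ (integralClosure_map_algEquiv e))).toRingEquiv
  let e₂ := ((fromSpecFunctionField X).normalizationObjIso hU).commRingCatIsoToRingEquiv
  haveI hB : IsIntegrallyClosed Γ(normalization X, normalizationι X ⁻¹ᵁ U) :=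
    IsIntegrallyClosed.of_equiv (e₁.trans e₂.symm)
  -- localise
  have hloc := isIntegrallyClosed_of_isLocalization
    ((normalization X).presheaf.stalk ((⟨x, hxU⟩ : ↥(normalizationι X ⁻¹ᵁ U)) : normalization X))
    (hV.primeIdealOf ⟨x, hxU⟩).asIdeal.primeCompl
    (hV.primeIdealOf ⟨x, hxU⟩).asIdeal.primeCompl_le_nonZeroDivisors
  exact hloc

variable {X}

/-- **The normalisation of a variety is generically étale** (indeed an isomorphism over a dense
open: over a non-empty affine open with integrally closed coordinate ring,
`isIso_normalizationι_morphismRestrict`, `exists_isAffineOpen_isIntegrallyClosed`), as required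
in 4.4/4.10. [cite: DeJong1996, 4.10, p. 67] -/
theorem isGenericallyEtale_normalizationι {k : Type u} [Field k] (f : X ⟶ Spec (.of k))
    [LocallyOfFiniteType f] : IsGenericallyEtale (normalizationι X) := by
  obtain ⟨W, hW, hWne, hic⟩ :=
    exists_isAffineOpen_isIntegrallyClosed X NoetherFiniteIntegralClosure_holds f
  haveI := isIso_normalizationι_morphismRestrict X hW hWne hic
  refine IsGenericallyEtale.of_isIso_morphismRestrict (normalizationι X) W ?_
  refine (normalizationι X ⁻¹ᵁ W).2.dense ?_
  obtain ⟨y, hy⟩ := (normalizationι X).denseRange.exists_mem_open W.2 hWne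
  exact ⟨y, hy⟩

/-- **The normalisation of a projective variety is projective** ("(iii) holds as long as we only
take projective alterations `φ`. In particular, taking `φ` equal to the normalization morphism",
de Jong 1996, 4.10): `X^ν → X ↪ ℙⁿ_k` is finite (E. Noether) and `X^ν` is proper over `k`, and
a proper `k`-scheme finite over `ℙⁿ_k` is projective (Görtz–Wedhorn I, Thm. 13.84 with
Cor. 13.72; `Literature.AlgebraicGeometry.Motives.isProjectiveOver_of_isFinite`).
[cite: DeJong1996, 4.10, p. 67] -/
theorem isProjectiveOver_normalization {k : Type u} [Field k] (f : X ⟶ Spec (.of k))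
    (hproj : Motives.IsProjectiveOver (Over.mk f)) :
    Motives.IsProjectiveOver (Over.mk (normalizationι X ≫ f)) := by
  haveI : IsProper f := Motives.IsProjectiveOver.isProper hproj
  obtain ⟨n, ι, hι⟩ := hproj
  -- the closed immersion `X ↪ ℙⁿ_k`, retyped with source `X`
  let ι' : X ⟶ (Motives.projectiveSpace n k).left := ι.left
  haveI : IsClosedImmersion ι' := hι
  have hf : ι' ≫ (Motives.projectiveSpace n k).hom = f := Over.w ι
  haveI : IsFinite (normalizationι X) :=
    isFinite_normalizationι X NoetherFiniteIntegralClosure_holds f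
  haveI : IsProper (Over.mk (normalizationι X ≫ f) : Motives.SchemeOver k).hom :=
    inferInstanceAs (IsProper (normalizationι X ≫ f))
  have hw : (normalizationι X ≫ ι') ≫ (Motives.projectiveSpace n k).hom =
      (Over.mk (normalizationι X ≫ f) : Motives.SchemeOver k).hom := by
    rw [Category.assoc, hf]
    rfl
  haveI : IsFinite (Over.homMk (normalizationι X ≫ ι') hw :
      (Over.mk (normalizationι X ≫ f) : Motives.SchemeOver k) ⟶ Motives.projectiveSpace n k).left :=
    inferInstanceAs (IsFinite (normalizationι X ≫ ι'))
  exact Motives.isProjectiveOver_of_isFinite (Over.homMk (normalizationι X ≫ ι') hw)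

end Normalization

namespace DeJong1996

/-! ## 4.10: reduction to normal `X` -/

/-- **de Jong 1996, 4.10** (PROVED): "The property (iv) is preserved if we apply any alteration
`φ : X' → X` as in 4.4. The property (i) is trivially preserved, and (iii) holds as long as we
only take projective alterations `φ`. In particular, taking `φ` equal to the normalization
morphism we may assume in addition to (i)–(iv) that we have (v) `X` is a normal variety."
Precisely: over any field `k`, for `X` a projective variety and `Z` the support of an effective
Cartier divisor, Thm. 4.1 with its generically-étale clause for `(X, Z)` follows from the same
statement for all normal projective pairs (`NormalProjectivePair`) of the same dimension — via
the normalisation `ν : X^ν → X`, a finite generically étale alteration with `X^ν` normal and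
projective and `ν⁻¹(Z)` the support of the pulled-back divisor, and 4.4.
[cite: DeJong1996, 4.10, p. 67] -/
theorem conclusionGenericallyEtale_of_normal {k : Type u} [Field k] {X : Scheme.{u}}
    (f : X ⟶ Spec (.of k)) [IsIntegral X] (hproj : Motives.IsProjectiveOver (Over.mk f))
    {Z : Set X} (hD : ∃ D : X.IdealSheafData, IsEffectiveCartier D ∧ (D.support : Set X) = Z)
    (H : ∀ (X' : Scheme.{u}) (f' : X' ⟶ Spec (.of k)) (Z' : Set X'), NormalProjectivePair f' Z' →
      topologicalKrullDim X' = topologicalKrullDim X → ConclusionGenericallyEtale f' Z') :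
    ConclusionGenericallyEtale f Z := by
  haveI : IsProper f := Motives.IsProjectiveOver.isProper hproj
  have hνa : IsAlteration (normalizationι X) :=
    isAlteration_normalizationι X NoetherFiniteIntegralClosure_holds f
  haveI : IsFinite (normalizationι X) :=
    isFinite_normalizationι X NoetherFiniteIntegralClosure_holds f
  refine ConclusionGenericallyEtale.of_isAlteration hνa (isGenericallyEtale_normalizationι f) ?_
  refine H (normalization X) (normalizationι X ≫ f) (normalizationι X ⁻¹' Z) ?_
    (hνa.topologicalKrullDim_eq f)
  obtain ⟨D, hD, hDZ⟩ := hD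
  exact
    { isIntegral := inferInstance
      isProjectiveOver := isProjectiveOver_normalization f hproj
      exists_isEffectiveCartier := ⟨D.comap (normalizationι X), hD.comap_of_isDominant _, by
        rw [Scheme.IdealSheafData.support_comap, TopologicalSpace.Closeds.coe_preimage, hDZ]⟩
      isIntegrallyClosed := isIntegrallyClosed_stalk_normalization X }

end DeJong1996

/-! ## `DeJong1996NormalizationReduction` discharged; the assembly -/

/-- **DISCHARGE of the named fact `DeJong1996NormalizationReduction`** (de Jong 1996, 4.10 with
4.9, `AlterationsBlowupDivisor.lean`): the reduction of projective pairs with `Z` the support of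
a divisor to normal projective pairs of the same dimension, by
`DeJong1996.conclusionGenericallyEtale_of_normal` (the algebraic closedness of `k` and the
hypotheses `IsClosed Z`, `Z ≠ X` of the fact are not needed). [cite: DeJong1996, 4.10, p. 67] -/
theorem DeJong1996NormalizationReduction_holds : DeJong1996NormalizationReduction.{u} := by
  intro k _ _ X f Z hi hproj _ _ hD H
  haveI := hi
  exact DeJong1996.conclusionGenericallyEtale_of_normal f hproj hD H

/-- **`DeJong1996NormalProjectiveReduction` (de Jong 1996, 4.6–4.10) from the projectivity of
blow-ups alone** (Hartshorne II.7.16 (c), `BlowupProjectiveOverField`): 4.6, 4.7, 4.8 and now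
4.10 are proved (`DeJong1996NormalProjectiveReduction.of_blowupProjective_of_normalization` with
`DeJong1996NormalizationReduction_holds`). [cite: DeJong1996, 4.6–4.10, pp. 66–67] -/
theorem DeJong1996NormalProjectiveReduction.of_blowupProjective (hB : BlowupProjectiveOverField.{u}) :
    DeJong1996NormalProjectiveReduction.{u} :=
  DeJong1996NormalProjectiveReduction.of_blowupProjective_of_normalization hB
    DeJong1996NormalizationReduction_holds

/-- **The induction step of Thm. 4.1** from the projectivity of blow-ups (Hartshorne II.7.16 (c))
and the step for normal projective pairs (4.11–4.28, `DeJong1996NormalProjectiveStep`), by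
4.6–4.10. [cite: DeJong1996, 4.6–4.10, pp. 66–67] -/
theorem DeJong1996InductionStep.of_blowupProjective_of_step (hB : BlowupProjectiveOverField.{u})
    (hstep : DeJong1996NormalProjectiveStep.{u}) : DeJong1996InductionStep.{u} :=
  DeJong1996InductionStep.of_reduction_of_step
    (DeJong1996NormalProjectiveReduction.of_blowupProjective hB) hstep

/-- **`DeJong1996StrongAlgClosed` (Thm. 4.1 with its generically-étale clause over algebraically
closed fields) from the projectivity of blow-ups (Hartshorne II.7.16 (c)) and de Jong 1996,
4.11–4.28 (`DeJong1996NormalProjectiveStep`)** — 4.3, 4.4, 4.6–4.10 and the induction on the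
dimension being proved. [cite: DeJong1996, 4.3–4.10, pp. 66–67] -/
theorem DeJong1996StrongAlgClosed.of_blowupProjective_of_step (hB : BlowupProjectiveOverField.{u})
    (hstep : DeJong1996NormalProjectiveStep.{u}) : DeJong1996StrongAlgClosed.{u} :=
  DeJong1996StrongAlgClosed.of_inductionStep (DeJong1996InductionStep.of_blowupProjective_of_step hB hstep)

/-- Thm. 4.1 (i)+(ii) over every field from 4.5 (`DeJong1996Descent`), Hartshorne II.7.16 (c)
and 4.11–4.28. [cite: DeJong1996, 4.3–4.10, pp. 66–67] -/
theorem DeJong1996Strong.of_descent_of_blowupProjective_of_step (h45 : DeJong1996Descent.{u})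
    (hB : BlowupProjectiveOverField.{u}) (hstep : DeJong1996NormalProjectiveStep.{u}) :
    DeJong1996Strong.{u} :=
  DeJong1996Strong.of_descent_of_inductionStep h45
    (DeJong1996InductionStep.of_blowupProjective_of_step hB hstep)

/-- The last sentence of Thm. 4.1 (perfect fields) from the same three inputs.
[cite: DeJong1996, 4.3–4.10, pp. 66–67] -/
theorem DeJong1996StrongPerfect.of_descent_of_blowupProjective_of_step
    (h45 : DeJong1996Descent.{u}) (hB : BlowupProjectiveOverField.{u})
    (hstep : DeJong1996NormalProjectiveStep.{u}) : DeJong1996StrongPerfect.{u} :=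
  DeJong1996StrongPerfect.of_descent_of_inductionStep h45
    (DeJong1996InductionStep.of_blowupProjective_of_step hB hstep)

/-- `DeJong1996Projective` (Thm. 4.1 (i)) from the same three inputs. [cite: DeJong1996, Thm. 4.1, p. 66] -/
theorem DeJong1996Projective.of_descent_of_blowupProjective_of_step (h45 : DeJong1996Descent.{u})
    (hB : BlowupProjectiveOverField.{u}) (hstep : DeJong1996NormalProjectiveStep.{u}) :
    DeJong1996Projective.{u} :=
  (DeJong1996Strong.of_descent_of_blowupProjective_of_step h45 hB hstep).projective

end Literature.AlgebraicGeometry.Resolution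

end
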